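import Summits.AnomalousDissipation.AnomalousDissipation.Theses.RootDecompCycle2B

/-!
# Glue item `RootDecompCycle2B.LoudnessRecurrenceGlue` (stmt-AnomalousDissipation-28110)

Sorry-free proof of the GLUE item of route `route-AnomalousDissipation-RootDecompCycle2B`: `RoughRecurrence → NoIntermediateRate → RateAttainment → LoudnessRecurrence` (RateLadder split of 26353).
Pure logic (composition of the pieces / modus ponens); no facts asserted.
Source: decomp-ad cell (lens-1 RateLadder node, kernel loudnessRecurrence_of_children / writer sketch loudnessRecurrenceGlue_w_holds); landed by the cell's prover seat.  Nothing here proves the summit.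
-/

set_option linter.dupNamespace false

namespace Summit.AnomalousDissipation.AnomalousDissipation.Theorems.CellGlue

open Summit.AnomalousDissipation.AnomalousDissipation.Theses
open Summit.AnomalousDissipation.AnomalousDissipation.Theses.RootDecompCycle2B

/-- GLUE item 28110 `LoudnessRecurrenceGlue` by name (composition of the filed pieces). [folklore] -/
theorem loudnessRecurrenceGlue_holds : RootDecompCycle2B.LoudnessRecurrenceGlue :=
  fun hP hN hC hM₁ => hC (hN (hP hM₁))

end Summit.AnomalousDissipation.AnomalousDissipation.Theorems.CellGlue
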